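import Literature.Analysis.FluidPDE.KinematicApexWitness
import Literature.Analysis.FluidPDE.SwirlTransportProofs
import Literature.Analysis.FluidPDE.LocalTypeI
import Literature.Analysis.FluidPDE.PineauVicolRSSProofs
import Literature.Analysis.FluidPDE.SereginZajaczkowski2007L42VorticityEnergy
import Summits.NavierStokesRegularity.NavierStokesRegularity.Theorems.TypeITraceScarL3.Negative.StubCFalseWithoutNS
import HarnessLib

/-!
# The divergence-free TRAVELLING SWIRL: kinematic witness profile for the shell stubs and the
# vorticity cut C1′ of crux `TypeITraceScarL3` (stmt-NavierStokesRegularity-18385), part 1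

Negative-lane lemma file of the disprover seat `cdisprove-stmt-NavierStokesRegularity-18385`
(`--supports` the item).  The profile is the compactly supported, DIVERGENCE-FREE, Type-I swirl
`S(t, x) = χ(‖x‖²/(−t))/(2(−t)) · Jx` (`J` the rotation generator `rotGen`, `χ` the tree's `cutoff`),
carried along an arbitrary centre path `c : ℝ → ℝ³`: `U(t, x) = S(t, x − c(t))` (`swirlTravel`).
This part: the definitions (profile, travelling copy, their classical gradients, and the LOUD centre
path `loudPath`, an oscillating radius `loudRadius` sweeping every shell at arbitrarily late times), the
rate `‖S‖ ≤ 1/√(−t)`, the support `B(0, 2√(−t))`, the peak value `1/(2√(−t))` at `√(−t)e₀`, the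
classical derivative with its operator-norm bound `(1/2 + 4L)/(−t)`, `div S(t,·) = 0` classically,
`(curl S(t,·))(0)·e₂ = (−t)⁻¹ ≠ 0`, and smoothness on the open slab `t < 0`.  Parts 2–4
(`SwirlWitnessTypeI`, `C1PrimeFalseWithoutNS`, `StubLOUDFalseWithoutNS`) do the Type-I bookkeeping and
the two census theorems.  WHAT THIS IS NOT: not a Navier–Stokes solution; not NS regularity (neither
proved nor refuted here). [folklore; AlbrittonBarker2019 §1; KNSS2009 (1.4)]
-/


noncomputable section

set_option linter.dupNamespace false

namespace Summit.NavierStokesRegularity.NavierStokesRegularity.Theorems.TypeITraceScarL3.Negative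

open MeasureTheory Set Function Filter Topology Metric TopologicalSpace
open Literature.Analysis.FluidPDE Literature.Analysis.FluidPDE.ParabolicBump
open scoped NNReal ENNReal InnerProductSpace RealInnerProductSpace

/-! ### The swirl profile -/

/-- Amplitude `φ(t, x) = χ(‖x‖²/(−t)) / (2(−t))`. [folklore] -/
def swirlAmp (t : ℝ) (x : EuclideanSpace ℝ (Fin 3)) : ℝ :=
  ParabolicBump.cutoff (‖x‖ ^ 2 / (-t)) / (2 * (-t))

/-- Its spatial derivative `Dφ(t, ·)(x) = (2(−t))⁻¹ χ'(‖x‖²/(−t)) (−t)⁻¹ 2⟨x, ·⟩`. [folklore] -/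
def swirlAmpDeriv (t : ℝ) (x : EuclideanSpace ℝ (Fin 3)) : EuclideanSpace ℝ (Fin 3) →L[ℝ] ℝ :=
  (2 * (-t))⁻¹ •
    (deriv ParabolicBump.cutoff (‖x‖ ^ 2 * (-t)⁻¹) • ((-t)⁻¹ • ((2 : ℝ) • innerSL ℝ x)))

/-- **The swirl** `S(t, x) = φ(t, x) Jx`, `Jx = (−x₁, x₀, 0)`. [folklore] -/
def swirlVelocity : ℝ → EuclideanSpace ℝ (Fin 3) → EuclideanSpace ℝ (Fin 3) :=
  fun t x => swirlAmp t x • rotGen x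

/-- Its classical spatial gradient `φ J + (Dφ) ⊗ Jx`. [folklore] -/
def swirlGradient : ℝ → EuclideanSpace ℝ (Fin 3) →
    EuclideanSpace ℝ (Fin 3) →L[ℝ] EuclideanSpace ℝ (Fin 3) :=
  fun t x => swirlAmp t x • rotGenL + (swirlAmpDeriv t x).smulRight (rotGen x)

/-- **The travelling swirl** `U(t, x) = S(t, x − c(t))` along a centre path `c`. [folklore] -/
def swirlTravel (c : ℝ → EuclideanSpace ℝ (Fin 3)) :
    ℝ → EuclideanSpace ℝ (Fin 3) → EuclideanSpace ℝ (Fin 3) :=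
  fun t x => swirlVelocity t (x - c t)

/-- Its classical spatial gradient `∇S(t, x − c(t))`. [folklore] -/
def swirlTravelGradient (c : ℝ → EuclideanSpace ℝ (Fin 3)) :
    ℝ → EuclideanSpace ℝ (Fin 3) → EuclideanSpace ℝ (Fin 3) →L[ℝ] EuclideanSpace ℝ (Fin 3) :=
  fun t x => swirlGradient t (x - c t)

/-! ### The LOUD centre path (used in part 4) -/

/-- The oscillating radius `ρ(t) = 4√(−t) · exp((−t)⁻¹ (1 + sin((−t)⁻¹)))`. [folklore] -/
def loudRadius (t : ℝ) : ℝ :=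
  4 * Real.sqrt (-t) * Real.exp ((-t)⁻¹ * (1 + Real.sin (-t)⁻¹))

/-- The LOUD centre path `c(t) = ρ(t) e₀`. [folklore] -/
def loudPath (t : ℝ) : EuclideanSpace ℝ (Fin 3) := loudRadius t • parasiticDir

/-! ### Pointwise facts for the profile -/

/-- `φ(t, ·) = 0` where `‖x‖² ≥ 2(−t)`. [folklore] -/
theorem swirlAmp_eq_zero_of {t : ℝ} (ht : t < 0) {x : EuclideanSpace ℝ (Fin 3)}
    (hx : 2 * (-t) ≤ ‖x‖ ^ 2) : swirlAmp t x = 0 := by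
  unfold swirlAmp
  rw [ParabolicBump.cutoff_of_two_le, zero_div]
  rwa [le_div_iff₀ (by linarith)]

/-- `φ(t, x) = 1/(2(−t))` where `‖x‖² ≤ −t`. [folklore] -/
theorem swirlAmp_eq_of {t : ℝ} (ht : t < 0) {x : EuclideanSpace ℝ (Fin 3)} (hx : ‖x‖ ^ 2 ≤ -t) :
    swirlAmp t x = 1 / (2 * (-t)) := by
  unfold swirlAmp
  rw [ParabolicBump.cutoff_of_le_one]
  rwa [div_le_one (by linarith)]

/-- `φ ≥ 0` for `t < 0`. [folklore] -/
theorem swirlAmp_nonneg {t : ℝ} (ht : t < 0) (x : EuclideanSpace ℝ (Fin 3)) : 0 ≤ swirlAmp t x :=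
  div_nonneg (ParabolicBump.cutoff_nonneg _) (by linarith)

/-- `φ ≤ 1/(2(−t))` for `t < 0`. [folklore] -/
theorem swirlAmp_le {t : ℝ} (ht : t < 0) (x : EuclideanSpace ℝ (Fin 3)) :
    swirlAmp t x ≤ 1 / (2 * (-t)) :=
  div_le_div_of_nonneg_right (ParabolicBump.cutoff_le_one _) (by linarith)

/-- **The rate**: `‖S(t, x)‖ ≤ 1/√(−t)`. [folklore] -/
theorem norm_swirlVelocity_le {t : ℝ} (ht : t < 0) (x : EuclideanSpace ℝ (Fin 3)) :
    ‖swirlVelocity t x‖ ≤ 1 / Real.sqrt (-t) := by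
  have hnt : 0 < -t := by linarith
  have hs : 0 < Real.sqrt (-t) := Real.sqrt_pos.2 hnt
  show ‖swirlAmp t x • rotGen x‖ ≤ _
  rw [norm_smul, Real.norm_of_nonneg (swirlAmp_nonneg ht x)]
  by_cases hx : 2 * (-t) ≤ ‖x‖ ^ 2
  · rw [swirlAmp_eq_zero_of ht hx, zero_mul]; positivity
  · rw [not_le] at hx
    have hxn : ‖x‖ < 2 * Real.sqrt (-t) := by
      have h4 : ‖x‖ ^ 2 < (2 * Real.sqrt (-t)) ^ 2 := by
        rw [mul_pow, Real.sq_sqrt hnt.le]; linarith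
      exact (pow_lt_pow_iff_left₀ (norm_nonneg _) (by positivity) two_ne_zero).1 h4
    have key : Real.sqrt (-t) * Real.sqrt (-t) = -t := Real.mul_self_sqrt hnt.le
    calc swirlAmp t x * ‖rotGen x‖ ≤ 1 / (2 * (-t)) * (2 * Real.sqrt (-t)) :=
          mul_le_mul (swirlAmp_le ht x) ((PineauVicol2026.norm_rotGen_le x).trans hxn.le) (norm_nonneg _)
            (by positivity)
      _ = 1 / Real.sqrt (-t) := by
          rw [div_mul_eq_mul_div, one_mul, div_eq_div_iff (by positivity) hs.ne']
          linear_combination 2 * key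

/-- Off the ball `‖x‖ < 2√(−t)` the swirl vanishes. [folklore] -/
theorem swirlVelocity_eq_zero_of {t : ℝ} (ht : t < 0) {x : EuclideanSpace ℝ (Fin 3)}
    (hx : 2 * Real.sqrt (-t) ≤ ‖x‖) : swirlVelocity t x = 0 := by
  have h4 : 2 * (-t) ≤ ‖x‖ ^ 2 := by
    have hs := Real.sq_sqrt (show 0 ≤ -t by linarith)
    nlinarith [Real.sqrt_nonneg (-t)]
  show swirlAmp t x • rotGen x = 0
  rw [swirlAmp_eq_zero_of ht h4, zero_smul]

/-- `‖J e₀‖ = 1`. [folklore] -/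
theorem norm_rotGen_parasiticDir : ‖rotGen parasiticDir‖ = 1 := by
  rw [show parasiticDir = EuclideanSpace.single 0 1 from rfl, rotGen_single_zero]
  simp

/-- **The peak value**: `‖S(t, √(−t) e₀)‖ = 1/(2√(−t))`. [folklore] -/
theorem norm_swirlVelocity_peak {t : ℝ} (ht : t < 0) :
    ‖swirlVelocity t (Real.sqrt (-t) • parasiticDir)‖ = 1 / (2 * Real.sqrt (-t)) := by
  have hnt : 0 < -t := by linarith
  have hs : 0 < Real.sqrt (-t) := Real.sqrt_pos.2 hnt
  have hn : ‖Real.sqrt (-t) • parasiticDir‖ ^ 2 ≤ -t := by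
    rw [norm_smul, norm_parasiticDir, mul_one, Real.norm_of_nonneg hs.le, Real.sq_sqrt hnt.le]
  show ‖swirlAmp t _ • rotGen _‖ = _
  rw [swirlAmp_eq_of ht hn, rotGen_smul, norm_smul, norm_smul, norm_rotGen_parasiticDir, mul_one,
    Real.norm_of_nonneg hs.le, Real.norm_of_nonneg (by positivity), div_mul_eq_mul_div, one_mul,
    div_eq_div_iff (by positivity) (by positivity)]
  have key : Real.sqrt (-t) * Real.sqrt (-t) = -t := Real.mul_self_sqrt hnt.le
  linear_combination 2 * key

/-! ### The classical derivative -/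

/-- Chain rule for the amplitude. [folklore] -/
theorem hasFDerivAt_swirlAmp (t : ℝ) (x : EuclideanSpace ℝ (Fin 3)) :
    HasFDerivAt (swirlAmp t) (swirlAmpDeriv t x) x := by
  have e : swirlAmp t = fun y => ParabolicBump.cutoff (‖y‖ ^ 2 * (-t)⁻¹) * (2 * (-t))⁻¹ := by
    funext y; simp only [swirlAmp, div_eq_mul_inv]
  rw [e]
  have h1 : HasFDerivAt (fun y : EuclideanSpace ℝ (Fin 3) => ‖y‖ ^ 2) ((2 : ℝ) • innerSL ℝ x) x :=
    (hasStrictFDerivAt_norm_sq x).hasFDerivAt.congr_fderiv (by rw [two_smul, two_smul])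
  have h2 : HasFDerivAt (fun y : EuclideanSpace ℝ (Fin 3) => ‖y‖ ^ 2 * (-t)⁻¹)
      ((-t)⁻¹ • ((2 : ℝ) • innerSL ℝ x)) x := h1.mul_const _
  have h3 : HasFDerivAt (fun y : EuclideanSpace ℝ (Fin 3) => ParabolicBump.cutoff (‖y‖ ^ 2 * (-t)⁻¹))
      (deriv ParabolicBump.cutoff (‖x‖ ^ 2 * (-t)⁻¹) • ((-t)⁻¹ • ((2 : ℝ) • innerSL ℝ x))) x :=
    (ParabolicBump.hasDerivAt_cutoff _).comp_hasFDerivAt x h2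
  exact h3.mul_const _

/-- **Product rule**: `DS(t, ·)(x) = φ J + (Dφ) ⊗ Jx`. [folklore] -/
theorem hasFDerivAt_swirlVelocity (t : ℝ) (x : EuclideanSpace ℝ (Fin 3)) :
    HasFDerivAt (swirlVelocity t) (swirlGradient t x) x :=
  (hasFDerivAt_swirlAmp t x).smul (hasFDerivAt_rotGen x)

/-- Hence `fderiv (S t) = ∇S`. [folklore] -/
theorem fderiv_swirlVelocity (t : ℝ) (x : EuclideanSpace ℝ (Fin 3)) :
    fderiv ℝ (swirlVelocity t) x = swirlGradient t x :=
  (hasFDerivAt_swirlVelocity t x).fderiv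

/-- Norm of the amplitude derivative. [folklore] -/
theorem norm_swirlAmpDeriv (t : ℝ) (x : EuclideanSpace ℝ (Fin 3)) :
    ‖swirlAmpDeriv t x‖ =
      |(2 * (-t))⁻¹| * (|deriv ParabolicBump.cutoff (‖x‖ ^ 2 * (-t)⁻¹)| * (|(-t)⁻¹| * (2 * ‖x‖))) := by
  rw [swirlAmpDeriv, norm_smul, norm_smul, norm_smul, norm_smul, innerSL_apply_norm, Real.norm_eq_abs,
    Real.norm_eq_abs, Real.norm_eq_abs, Real.norm_eq_abs, abs_two]

/-- The amplitude derivative vanishes off the ball `‖x‖ < 2√(−t)`. [folklore] -/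
theorem swirlAmpDeriv_eq_zero_of {t : ℝ} (ht : t < 0) {x : EuclideanSpace ℝ (Fin 3)}
    (hx : 2 * Real.sqrt (-t) ≤ ‖x‖) : swirlAmpDeriv t x = 0 := by
  have hnt : 0 < -t := by linarith
  have hsarg : 2 < ‖x‖ ^ 2 * (-t)⁻¹ := by
    rw [← div_eq_mul_inv, lt_div_iff₀ hnt]
    have h4 : (2 * Real.sqrt (-t)) ^ 2 ≤ ‖x‖ ^ 2 := pow_le_pow_left₀ (by positivity) hx 2
    rw [mul_pow, Real.sq_sqrt hnt.le] at h4
    linarith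
  rw [swirlAmpDeriv, ParabolicBump.deriv_cutoff_eq_zero_of_lt (Or.inr hsarg), zero_smul, smul_zero]

/-- The gradient vanishes off the ball `‖x‖ < 2√(−t)`. [folklore] -/
theorem swirlGradient_eq_zero_of {t : ℝ} (ht : t < 0) {x : EuclideanSpace ℝ (Fin 3)}
    (hx : 2 * Real.sqrt (-t) ≤ ‖x‖) : swirlGradient t x = 0 := by
  have h4 : 2 * (-t) ≤ ‖x‖ ^ 2 := by
    have hs := Real.sq_sqrt (show 0 ≤ -t by linarith)
    nlinarith [Real.sqrt_nonneg (-t)]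
  rw [swirlGradient, swirlAmp_eq_zero_of ht h4, swirlAmpDeriv_eq_zero_of ht hx]
  ext v i
  simp

/-- **Gradient bound on the support**: `‖∇S(t, x)‖ ≤ (1/2 + 4L)/(−t)` (`L` a bound for `χ'`). [folklore] -/
theorem norm_swirlGradient_le {L : ℝ} (hL0 : 0 ≤ L) (hL : ∀ s, |deriv ParabolicBump.cutoff s| ≤ L) {t : ℝ}
    (ht : t < 0) {x : EuclideanSpace ℝ (Fin 3)} (hxn : ‖x‖ ≤ 2 * Real.sqrt (-t)) :
    ‖swirlGradient t x‖ ≤ (1 / 2 + 4 * L) / (-t) := by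
  have hnt : 0 < -t := by linarith
  have hs : 0 < Real.sqrt (-t) := Real.sqrt_pos.2 hnt
  have key : Real.sqrt (-t) * Real.sqrt (-t) = -t := Real.mul_self_sqrt hnt.le
  have h1 : ‖swirlAmp t x • rotGenL‖ ≤ 1 / (2 * (-t)) * 1 := by
    rw [norm_smul, Real.norm_of_nonneg (swirlAmp_nonneg ht x)]
    exact mul_le_mul (swirlAmp_le ht x) SereginZajaczkowski2007.norm_rotGenL_le (norm_nonneg _) (by positivity)
  have h2 : ‖(swirlAmpDeriv t x).smulRight (rotGen x)‖ ≤
      (2 * (-t))⁻¹ * (L * ((-t)⁻¹ * (2 * (2 * Real.sqrt (-t))))) * (2 * Real.sqrt (-t)) := by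
    rw [ContinuousLinearMap.norm_smulRight_apply, norm_swirlAmpDeriv, abs_of_pos (by positivity),
      abs_of_pos (inv_pos.2 hnt)]
    have hd := hL (‖x‖ ^ 2 * (-t)⁻¹)
    have hJ : ‖rotGen x‖ ≤ 2 * Real.sqrt (-t) := (PineauVicol2026.norm_rotGen_le x).trans hxn
    gcongr
  calc ‖swirlGradient t x‖ ≤ ‖swirlAmp t x • rotGenL‖ + ‖(swirlAmpDeriv t x).smulRight (rotGen x)‖ :=
        norm_add_le _ _
    _ ≤ 1 / (2 * (-t)) * 1 +
          (2 * (-t))⁻¹ * (L * ((-t)⁻¹ * (2 * (2 * Real.sqrt (-t))))) * (2 * Real.sqrt (-t)) :=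
        add_le_add h1 h2
    _ = 1 / (2 * (-t)) + (2 * (-t))⁻¹ * L * (-t)⁻¹ * 8 * (Real.sqrt (-t) * Real.sqrt (-t)) := by ring
    _ = (1 / 2 + 4 * L) / (-t) := by
        rw [key]
        field_simp
        ring

/-! ### Divergence zero, curl nonzero at the centre -/

/-- **`div S(t, ·) = 0` classically** (`⟨eᵢ, J eᵢ⟩ = 0` and `⟨x, Jx⟩ = 0`). [folklore] -/
theorem divergence_swirlVelocity (t : ℝ) (x : EuclideanSpace ℝ (Fin 3)) :
    VectorCalculus.divergence (swirlVelocity t) x = 0 := by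
  rw [divergence_eq_sum_inner_fderiv (EuclideanSpace.basisFun (Fin 3) ℝ), fderiv_swirlVelocity]
  simp [EuclideanSpace.basisFun_apply, swirlGradient, Fin.sum_univ_three, inner_add_right,
    EuclideanSpace.inner_single_left, EuclideanSpace.inner_single_right, rotGen,
    swirlAmpDeriv, innerSL_apply_apply]
  ring

/-- **The vorticity at the centre**: `(curl S(t, ·))(0) · e₂ = 2φ(t, 0) = (−t)⁻¹`. [folklore] -/
theorem curl_swirlVelocity_zero_apply_two {t : ℝ} (ht : t < 0) :
    curl (swirlVelocity t) 0 2 = (-t)⁻¹ := by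
  have hD : fderiv ℝ (swirlVelocity t) 0 = swirlAmp t 0 • rotGenL := by
    rw [fderiv_swirlVelocity, swirlGradient]
    have : rotGen (0 : EuclideanSpace ℝ (Fin 3)) = 0 := map_zero rotGenL
    rw [this, ContinuousLinearMap.smulRight_zero, add_zero]
  have ha : swirlAmp t 0 = 1 / (2 * (-t)) := swirlAmp_eq_of ht (by simp; linarith)
  simp [curl, hD, ha, rotGen]
  ring

/-! ### Smoothness -/

/-- Every time slice of the swirl is smooth. [folklore] -/
theorem contDiff_swirlVelocity_slice {n : ℕ∞} (t : ℝ) : ContDiff ℝ n (swirlVelocity t) := by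
  have h1 : ContDiff ℝ n (swirlAmp t) := by
    unfold swirlAmp
    exact (ParabolicBump.contDiff_cutoff.comp ((contDiff_norm_sq ℝ).div_const _)).div_const _
  have h2 : ContDiff ℝ n (rotGen : EuclideanSpace ℝ (Fin 3) → EuclideanSpace ℝ (Fin 3)) :=
    rotGenL.contDiff
  exact h1.smul h2

/-- The amplitude is smooth on the open slab `t < 0`. [folklore] -/
theorem contDiffOn_swirlAmp {n : ℕ∞} :
    ContDiffOn ℝ n (uncurry swirlAmp) (Iio 0 ×ˢ (univ : Set (EuclideanSpace ℝ (Fin 3)))) := by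
  have hne : ∀ z ∈ Iio (0 : ℝ) ×ˢ (univ : Set (EuclideanSpace ℝ (Fin 3))), -z.1 ≠ 0 := fun z hz => by
    have := hz.1
    simp only [mem_Iio] at this
    linarith
  have hne2 : ∀ z ∈ Iio (0 : ℝ) ×ˢ (univ : Set (EuclideanSpace ℝ (Fin 3))), 2 * (-z.1) ≠ 0 :=
    fun z hz => mul_ne_zero two_ne_zero (hne z hz)
  have h1 : ContDiffOn ℝ n (fun z : ℝ × EuclideanSpace ℝ (Fin 3) => ‖z.2‖ ^ 2 / (-z.1))
      (Iio 0 ×ˢ univ) :=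
    ((contDiff_norm_sq ℝ).comp contDiff_snd).contDiffOn.div contDiffOn_fst.neg hne
  have h2 : ContDiffOn ℝ n (fun z : ℝ × EuclideanSpace ℝ (Fin 3) => ParabolicBump.cutoff (‖z.2‖ ^ 2 / (-z.1)))
      (Iio 0 ×ˢ univ) :=
    ParabolicBump.contDiff_cutoff.comp_contDiffOn h1
  have h3 : ContDiffOn ℝ n (fun z : ℝ × EuclideanSpace ℝ (Fin 3) => 2 * (-z.1)) (Iio 0 ×ˢ univ) :=
    contDiffOn_const.mul contDiffOn_fst.neg
  exact h2.div h3 hne2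

/-- The swirl is smooth on the open slab `t < 0`. [folklore] -/
theorem contDiffOn_swirlVelocity {n : ℕ∞} :
    ContDiffOn ℝ n (uncurry swirlVelocity) (Iio 0 ×ˢ (univ : Set (EuclideanSpace ℝ (Fin 3)))) := by
  have h2 : ContDiff ℝ n (fun z : ℝ × EuclideanSpace ℝ (Fin 3) => rotGen z.2) :=
    rotGenL.contDiff.comp contDiff_snd
  exact contDiffOn_swirlAmp.smul h2.contDiffOn


end Summit.NavierStokesRegularity.NavierStokesRegularity.Theorems.TypeITraceScarL3.Negative

end
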